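import Literature.Barriers.QuantumFields.DiscreteSubgroupFreezingClusteringHolds
import Literature.Barriers.QuantumFields.AbelianDeconfinementD4Proofs
import Literature.MathematicalPhysics.QuantumLattice.ContinuumLimitLGT
import Literature.MathematicalPhysics.QuantumLattice.LatticeGaugeDLRLimitPointsProofs
import HarnessLib

/-!
# Discrete gauge groups freeze: the `ℤ_n` correlation length never diverges (no scaling regime)

Proof-only companion (barrier audit 2026-08-16, D-0021) of
`Literature/Barriers/QuantumFields/DiscreteSubgroupFreezing.lean`. The catalogue entry there
phrases the obstruction met by finite-subgroup approximations on the MASS GAP ("massive vs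
massless at large `β`"), which bites only against a target that is massless at large `β`
(`U(1)₄`) — against a massive target (the conjectured `SU(N)₄`; `U(1)₃` by Göpfert–Mack) the
frozen discrete theory agrees on massiveness (audit addendum of the barrier file,
`tracksMassGapD4_iff_of_eventuallyMassive`, proposed separately). What a frozen finite group can NEVER do is reach a scaling regime: this
file PROVES, for `ℤ_n ⊂ U(1)`, `n ≥ 2`, `d = 4`, Wilson action, torus limit states, that

* `zn_uniformClustering`: beyond `β_f(n)` every infinite-volume limit state clusters with the
  β-UNIFORM rate `1` (mass `≥ 1` in lattice units at every large `β`) — the in-tree vortex-gas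
  cluster expansion `abelianHiggs_torus_clustering` (rate `1`); the printed rate for every finite,
  possibly non-abelian, gauge group is `βΔ_G/2 → ∞` (Adhikari–Cao 2022, Thm. 1.1);
* `zn_corrLength_le_one`: hence any correlation length `ξ` of the plaquette–plaquette correlation
  in the sense of Chatterjee's Problem 5.1 (`HasInvCorrLength f ξ⁻¹`, `f` eventually positive)
  satisfies `ξ ≤ 1` at every large `β`;
* `zn_not_divergentCorrLength`: so the scaling clause "`ξ(β) → ∞` as `β → ∞`" of the lattice
  mass-gap problem (`Literature.MathematicalPhysics.QuantumFieldTheory.LatticeMassGapAllCouplings`,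
  Chatterjee arXiv:1803.01950 Problem 5.1) FAILS for every fixed `ℤ_n`: the frozen theory has a
  mass gap but no continuum limit — "a fixed finite subgroup is usable only below its own freezing
  coupling, never along `β → ∞` where continuum limits are taken" made precise.

No definitions, no named facts.

## References

* I. Montvay, G. Münster, *Quantum Fields on a Lattice* (CUP 1994), §3.7 (PDF p. 163), §3.7.1
  item 3 (PDF p. 164). [MontvayMunster1994]
* A. Adhikari, S. Cao, *Correlation decay for finite lattice gauge theories at weak coupling*,
  Ann. Probab. 53 (2025) 140–174, arXiv:2202.10375, Thm. 1. [AdhikariCao2025]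
* S. Chatterjee, *Yang–Mills for probabilists*, arXiv:1803.01950, Problem 5.1. [arXiv180301950]
-/

noncomputable section

open MeasureTheory Filter Topology ProbabilityTheory
open Literature.MathematicalPhysics.QuantumLattice Literature.MathematicalPhysics.QuantumFieldTheory
open Literature.Probability.LatticeModels

namespace Literature.Barriers.QuantumFields

/-! ### β-uniform clustering of the frozen `ℤ_n` theory -/

/-- **The frozen `ℤ_n` theory clusters with the β-UNIFORM rate `1`** (`n ≥ 2`, `d = 4`, Wilson
action): there is `β_f(n)` such that for every `β > β_f(n)`, every infinite-volume limit state
`μ ∈ infiniteVolumeLimitPoints (d := 4) (znRep n) β` and all bounded measurable gauge-invariant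
local observables `F₁, F₂`, `|Cov_μ(F₁, F₂ ∘ θ_x)| ≤ C(F₁,F₂) e^{-‖x‖_∞}` — the same rate at
every large `β` (mass `≥ 1` in lattice units): the torus vortex-gas cluster expansion
`abelianHiggs_torus_clustering` (rate `1`, gap `δ = actionGap (znRep n) = 1 − cos(2π/n) > 0`)
passed to limit points (`abs_covariance_le_of_eventually_along`). The printed rate for every
finite gauge group is `βΔ_G/2`, growing with `β` (Adhikari–Cao 2022, Thm. 1.1). [cite: MontvayMunster1994, §3.7.1 item 3 (PDF p. 164)] [cite: AdhikariCao2025, Thm. 1.1] -/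
theorem zn_uniformClustering {n : ℕ} (hn : 2 ≤ n) :
    ∃ β_f : ℝ, ∀ β : ℝ, β_f < β →
      ∀ μ ∈ infiniteVolumeLimitPoints (d := 4) (znRep n) β,
        ∀ F₁ F₂ : LGConfig 4 (rootsOfUnityCircle n) → ℝ,
          Literature.MathematicalPhysics.QuantumLattice.IsLocalObservable F₁ →
          Literature.MathematicalPhysics.QuantumLattice.IsLocalObservable F₂ →
          Measurable F₁ → Measurable F₂ →
          (∃ C, ∀ U, |F₁ U| ≤ C) → (∃ C, ∀ U, |F₂ U| ≤ C) →
          IsZdGaugeInvariant F₁ → IsZdGaugeInvariant F₂ →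
            HasExponentialDecayRate
              (fun x : Site 4 => cov[F₁, fun U => F₂ (configShift x U); μ]) 1 := by
  haveI : Fact (2 ≤ n) := ⟨hn⟩
  haveI : NeZero n := ⟨by omega⟩
  classical
  haveI : Fintype (rootsOfUnityCircle n) := Fintype.ofFinite _
  obtain ⟨β_f, h⟩ := abelianHiggs_torus_clustering (d := 4) (by norm_num) (znRep n)
    (continuous_znRep n) (actionGap_znRep_pos hn) (fun g hg => actionGap_znRep_le_one_sub_re hn g hg)
  refine ⟨β_f, fun β hβ μ hμ F₁ F₂ hF₁ hF₂ hm₁ hm₂ hb₁ hb₂ hg₁ hg₂ => ⟨one_pos, ?_⟩⟩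
  obtain ⟨C, hCx⟩ := h β hβ F₁ F₂ hF₁ hF₂ hb₁ hb₂ hg₁ hg₂
  obtain ⟨S₁, hS₁⟩ := hF₁
  obtain ⟨S₂, hS₂⟩ := hF₂
  obtain ⟨Ls, hLs, hlim⟩ := hμ
  exact ⟨C, fun x => abs_covariance_le_of_eventually_along (znRep n) hLs hlim hS₁ hS₂ hm₁ hm₂
    hb₁ hb₂ x (hCx x)⟩

/-! ### The plaquette–plaquette correlation of the frozen theory -/

/-- The `ℤ_n` plaquette observable is bounded by `1` (unitary `1 × 1` representation). [folklore] -/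
theorem abs_plaquetteObs_znRep_le (n : ℕ) (x : Site 4) (i j : Fin 4)
    (U : LGConfig 4 (rootsOfUnityCircle n)) : |plaquetteObs (znRep n) x i j U| ≤ 1 := by
  have h := abs_plaquetteObs_le_holds (d := 4) (znRep n) (znRep_mem_unitaryGroup n) x i j U
  simpa using h

/-- The `ℤ_n` plaquette observable is measurable. [folklore] -/
theorem measurable_plaquetteObs_znRep (n : ℕ) (x : Site 4) (i j : Fin 4) :
    Measurable (plaquetteObs (znRep n) x i j) :=
  measurable_plaquetteObs (znRep n) (continuous_znRep n) x i j

/-- In a probability state the covariance of the origin plaquette with its translate by `x` is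
the plaquette–plaquette correlation function at `−x` (as `covariance_plaquetteObs_configShift`
for `U(1)`). [folklore] -/
theorem covariance_plaquetteObs_configShift_znRep (n : ℕ)
    (μ : Measure (LGConfig 4 (rootsOfUnityCircle n))) [IsProbabilityMeasure μ] (x : Site 4) :
    cov[plaquetteObs (znRep n) 0 0 1, fun U => plaquetteObs (znRep n) 0 0 1 (configShift x U); μ] =
      plaquetteCorrFn (znRep n) μ (-x) := by
  have h2 : (fun U => plaquetteObs (d := 4) (znRep n) 0 0 1 (configShift x U)) =
      plaquetteObs (znRep n) (-x) 0 1 := by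
    funext U; rw [plaquetteObs_configShift, zero_sub]
  have hmem : ∀ y : Site 4, MemLp (plaquetteObs (znRep n) y 0 1) 2 μ := fun y =>
    MemLp.of_bound (measurable_plaquetteObs_znRep n y 0 1).aestronglyMeasurable 1
      (ae_of_all _ fun U => by
        simpa [Real.norm_eq_abs] using abs_plaquetteObs_znRep_le n y 0 1 U)
  rw [h2, covariance_eq_sub (hmem 0) (hmem _)]
  rfl

/-- **The plaquette–plaquette correlation of the frozen `ℤ_n` theory decays at rate `1`,
uniformly in `β`:** `|f_β(x)| ≤ C e^{-‖x‖_∞}` for every `β > β_f(n)` and every limit state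
(`zn_uniformClustering` at `F₁ = F₂ = Re U_{p₀}`). [cite: MontvayMunster1994, §3.7.1 item 3 (PDF p. 164)] -/
theorem zn_plaquetteCorrFn_decay {n : ℕ} (hn : 2 ≤ n) :
    ∃ β_f : ℝ, ∀ β : ℝ, β_f < β →
      ∀ μ ∈ infiniteVolumeLimitPoints (d := 4) (znRep n) β,
        HasExponentialDecayRate (plaquetteCorrFn (znRep n) μ) 1 := by
  obtain ⟨β_f, h⟩ := zn_uniformClustering hn
  refine ⟨β_f, fun β hβ μ hμ => ?_⟩
  have hP : IsProbabilityMeasure μ := by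
    obtain ⟨Ls, -, hlim⟩ := hμ
    exact hlim.1
  set P : LGConfig 4 (rootsOfUnityCircle n) → ℝ := plaquetteObs (znRep n) 0 0 1 with hPdef
  have h1 := h β hβ μ hμ P P (isLocalObservable_plaquetteObs (znRep n) 0 0 1)
    (isLocalObservable_plaquetteObs (znRep n) 0 0 1) (measurable_plaquetteObs_znRep n 0 0 1)
    (measurable_plaquetteObs_znRep n 0 0 1) ⟨1, abs_plaquetteObs_znRep_le n 0 0 1⟩
    ⟨1, abs_plaquetteObs_znRep_le n 0 0 1⟩ (isZdGaugeInvariant_plaquetteObs (znRep n) 0 0 1)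
    (isZdGaugeInvariant_plaquetteObs (znRep n) 0 0 1)
  simp only [hPdef, covariance_plaquetteObs_configShift_znRep] at h1
  -- `x ↦ f(−x)` decays at rate 1, hence so does `f` (‖−x‖ = ‖x‖)
  obtain ⟨h0, C, hC⟩ := h1
  refine ⟨h0, C, fun x => ?_⟩
  have := hC (-x)
  simp only [neg_neg, norm_neg] at this
  exact this

/-! ### Decay rate versus correlation length -/

/-- The `k`-th site on the first axis has sup norm `k`. [folklore] -/
theorem norm_natCast_zsmul_single {d : ℕ} [NeZero d] (k : ℕ) :
    ‖((k : ℤ) • Pi.single (0 : Fin d) (1 : ℤ) : Site d)‖ = k := by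
  have h : ((k : ℤ) • Pi.single (0 : Fin d) (1 : ℤ) : Site d) = Pi.single (0 : Fin d) (k : ℤ) := by
    ext j
    by_cases hj : j = 0
    · subst hj; simp
    · simp [hj]
  rw [h, Pi.norm_single]
  simp

/-- **An exponential decay rate bounds the inverse correlation length from below:** if
`|f x| ≤ C e^{-m‖x‖}` for all `x`, `f` is eventually non-zero along the first axis, and
`-log|f(k e₀)|/k → m'`, then `m ≤ m'` (`-log|f(k e₀)|/k ≥ m − (log C)/k → m`). [folklore] -/
theorem le_of_hasInvCorrLength_of_decay {d : ℕ} [NeZero d] {f : Site d → ℝ} {m m' : ℝ}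
    (hdec : HasExponentialDecayRate f m)
    (hne : ∀ᶠ k : ℕ in atTop, f ((k : ℤ) • Pi.single (0 : Fin d) (1 : ℤ)) ≠ 0)
    (hlim : HasInvCorrLength f m') : m ≤ m' := by
  obtain ⟨-, C, hC⟩ := hdec
  -- lower comparison sequence `m − (log C)/k → m`
  have hg : Tendsto (fun k : ℕ => m - Real.log C / k) atTop (𝓝 m) := by
    have : Tendsto (fun k : ℕ => m - Real.log C / (k : ℝ)) atTop (𝓝 (m - 0)) :=
      tendsto_const_nhds.sub (tendsto_const_nhds.div_atTop tendsto_natCast_atTop_atTop)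
    rwa [sub_zero] at this
  refine le_of_tendsto_of_tendsto hg hlim ?_
  filter_upwards [hne, eventually_gt_atTop 0] with k hk hk0
  have hk0' : (0 : ℝ) < k := by exact_mod_cast hk0
  have habs : 0 < |f ((k : ℤ) • Pi.single (0 : Fin d) (1 : ℤ))| := abs_pos.2 hk
  have hbound := hC ((k : ℤ) • Pi.single (0 : Fin d) (1 : ℤ))
  rw [norm_natCast_zsmul_single] at hbound
  have hCpos : 0 < C :=
    (mul_pos_iff_of_pos_right (Real.exp_pos _)).1 (lt_of_lt_of_le habs hbound)
  have hlog : Real.log |f ((k : ℤ) • Pi.single (0 : Fin d) (1 : ℤ))| ≤ Real.log C + -m * k := by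
    have := Real.log_le_log habs hbound
    rwa [Real.log_mul hCpos.ne' (Real.exp_pos _).ne', Real.log_exp] at this
  rw [le_div_iff₀ hk0']
  have : (m - Real.log C / k) * k = m * k - Real.log C := by field_simp
  rw [this]
  linarith

/-- **The correlation length of the frozen `ℤ_n` theory is at most one lattice spacing at every
large `β`:** for `β > β_f(n)`, every limit state `μ`, and every `ξ > 0` such that the
plaquette–plaquette correlation `f = plaquetteCorrFn (znRep n) μ` is eventually positive and has
inverse correlation length `ξ⁻¹` (the data of Chatterjee's Problem 5.1), `ξ ≤ 1`. [cite: MontvayMunster1994, §3.7.1 item 3 (PDF p. 164)] [cite: AdhikariCao2025, Thm. 1.1] -/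
theorem zn_corrLength_le_one {n : ℕ} (hn : 2 ≤ n) :
    ∃ β_f : ℝ, ∀ β : ℝ, β_f < β →
      ∀ μ ∈ infiniteVolumeLimitPoints (d := 4) (znRep n) β, ∀ ξ : ℝ, 0 < ξ →
        (∀ᶠ x in cofinite, 0 < plaquetteCorrFn (znRep n) μ x) →
        HasInvCorrLength (plaquetteCorrFn (znRep n) μ) ξ⁻¹ → ξ ≤ 1 := by
  obtain ⟨β_f, h⟩ := zn_plaquetteCorrFn_decay hn
  refine ⟨β_f, fun β hβ μ hμ ξ hξ hpos hlim => ?_⟩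
  have hdec := h β hβ μ hμ
  -- eventual non-vanishing along the axis, from eventual positivity on cofinite
  have hinj : Function.Injective fun k : ℕ => ((k : ℤ) • Pi.single (0 : Fin 4) (1 : ℤ) : Site 4) := by
    intro a b hab
    have := congrArg (fun x : Site 4 => ‖x‖) hab
    simp only [norm_natCast_zsmul_single] at this
    exact_mod_cast this
  have hax : Tendsto (fun k : ℕ => ((k : ℤ) • Pi.single (0 : Fin 4) (1 : ℤ) : Site 4)) atTop cofinite := by
    rw [← Nat.cofinite_eq_atTop]
    exact hinj.tendsto_cofinite
  have hne : ∀ᶠ k : ℕ in atTop, plaquetteCorrFn (znRep n) μ ((k : ℤ) • Pi.single (0 : Fin 4) (1 : ℤ)) ≠ 0 :=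
    (hax.eventually hpos).mono fun k hk => hk.ne'
  have h1 : (1 : ℝ) ≤ ξ⁻¹ := le_of_hasInvCorrLength_of_decay hdec hne hlim
  have := (one_le_inv₀ hξ).1 h1
  exact this

/-- **Barrier theorem (proved): a fixed `ℤ_n` has no scaling regime.** For `n ≥ 2` there is NO
correlation-length assignment `ξ(β, μ)` for four-dimensional `ℤ_n` lattice gauge theory which
(beyond some coupling) is positive, is the inverse decay rate of an eventually positive
plaquette–plaquette correlation in every infinite-volume limit state — the data of Chatterjee's
lattice mass-gap problem (`LatticeMassGapAllCouplings`, Problem 5.1) — AND diverges as `β → ∞`: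
at every large `β` the frozen theory has `ξ ≤ 1` (`zn_corrLength_le_one`; limit-point sets are
non-empty, `infiniteVolumeLimitPoints_nonempty_holds`). This is the attribute in which a fixed
finite subgroup provably cannot follow ANY continuum limit (`ξ(β) → ∞`), whatever the target's
phase; the mass-gap attribute of the catalogue entry is not (see the barrier file's addendum).
[cite: MontvayMunster1994, §3.7.1 item 3 with §3.7.2 (PDF p. 164)] [cite: arXiv180301950, §5 Problem 5.1] -/
theorem zn_not_divergentCorrLength {n : ℕ} (hn : 2 ≤ n) :
    ¬ ∃ ξ : ℝ → Measure (LGConfig 4 (rootsOfUnityCircle n)) → ℝ,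
      (∃ β₀ : ℝ, ∀ β : ℝ, β₀ < β → ∀ μ ∈ infiniteVolumeLimitPoints (d := 4) (znRep n) β,
          0 < ξ β μ ∧ (∀ᶠ x in cofinite, 0 < plaquetteCorrFn (znRep n) μ x) ∧
          HasInvCorrLength (plaquetteCorrFn (znRep n) μ) (ξ β μ)⁻¹) ∧
      ∀ M : ℝ, ∀ᶠ β in atTop, ∀ μ ∈ infiniteVolumeLimitPoints (d := 4) (znRep n) β, M ≤ ξ β μ := by
  rintro ⟨ξ, ⟨β₀, hξ⟩, hdiv⟩
  obtain ⟨β_f, hle⟩ := zn_corrLength_le_one hn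
  obtain ⟨β₂, hβ₂⟩ := (hdiv 2).exists_forall_of_atTop
  set β : ℝ := max (max β₀ β_f) β₂ + 1 with hβ
  have hb0 : β₀ < β := by
    have := le_max_left (max β₀ β_f) β₂; have := le_max_left β₀ β_f; linarith
  have hbf : β_f < β := by
    have := le_max_left (max β₀ β_f) β₂; have := le_max_right β₀ β_f; linarith
  have hb2 : β₂ ≤ β := by have := le_max_right (max β₀ β_f) β₂; linarith
  obtain ⟨μ, hμ⟩ := infiniteVolumeLimitPoints_nonempty_holds (d := 4) (znRep n) (continuous_znRep n) β
  obtain ⟨hpos, hev, hlim⟩ := hξ β hb0 μ hμ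
  have h1 : ξ β μ ≤ 1 := hle β hbf μ hμ (ξ β μ) hpos hev hlim
  have h2 : (2 : ℝ) ≤ ξ β μ := hβ₂ β hb2 μ hμ
  linarith

end Literature.Barriers.QuantumFields

end
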